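import Literature.Computability.AlgebraicComplexity.HopcroftKerrRowRestricted
import Literature.Computability.AlgebraicComplexity.MatMulSandwichRect
import HarnessLib

/-!
# Hopcroft–Kerr 1971, Lemma 7 on `⟨3,3,3⟩` minus one `X`-entry: row and column COMBINATIONS
# (isotropy transport inside the stabiliser of the deleted entry)

Topic `Literature/Computability/AlgebraicComplexity`. PROVED, no named facts, no new definitions.

`HopcroftKerrRowRestricted.lean` proves the Hopcroft–Kerr row inequality for the tensor
`T = ⟨3,3,3⟩` with the `X`-entry `X₀₀` deleted (`(a, b, c) ↦ ⟨3,3,3⟩_{a b c}`, `b ≠ (0,0)`) on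
COORDINATE rows and columns of the `X`-slot: products whose `X`-form is supported in row `i₀`
(`defRow_card_le` for the deficient row `i₀ = 0`, `fullRow_card_le` for `i₀ ≠ 0`) or in column
`j₀`.  Hopcroft–Kerr state their Lemma 7 for `a₁₁α, a₁₂β, (a₁₁+a₁₂)γ` and add (TR 69-44, p. 23):
"by transformations … similar theorems hold for `a₂₁α, …` and `(a₁₁+a₂₁)α, …`" — i.e. for the forms
reading a fixed row COMBINATION `xᵀX`.  For the full tensor this transport is the sandwich
symmetry `X ↦ PᵀX` with `P x = e_j` (`HopcroftKerrRowTransport.lean`, lit-1).  For the tensor with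
`X₀₀` deleted only the sandwiches FIXING the deleted coordinate act: `(P ⊗ Q)` must map `e_{(0,0)}`
to a multiple of itself, i.e. the columns `0` of `P` and of `Q` are multiples of `e₀`.  Under this
stabiliser the nonzero row vectors `x ∈ K³` fall into the class of `e₀` (the deficient row, two
admissible entries) and ONE class of full rows `{x : (x₁, x₂) ≠ 0}` containing `e₁, e₂` — so every
full row combination has the cap of a coordinate full row.

* `delete00_sum_triad_extend` — a decomposition of `⟨k+1,m+1,n⟩ ∖ X₀₀`, with the `X`-factors
  extended by `0` at `(0,0)`, sums to `⟨k+1,m+1,n⟩` with the `X₀₀`-slice zeroed;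
* `delete00_sum_triad_sandwich` — **transport**: for invertible `P, Q, R` with `P_{i0} = 0`
  (`i ≠ 0`) and `Q_{j0} = 0` (`j ≠ 0`), a decomposition `∑_ρ w_ρ ⊗ u_ρ ⊗ v_ρ` of `⟨k+1,m+1,n⟩ ∖ X₀₀`
  yields the decomposition `∑_ρ (P⁻ᵀ ⊗ R⁻ᵀ)w_ρ ⊗ ((P ⊗ Q)ū_ρ)|_{b ≠ (0,0)} ⊗ (Q⁻ᵀ ⊗ R)v_ρ` of the
  same tensor and length (sandwich invariance of `⟨k+1,m+1,n⟩`, `actTensor_sandwich_matMulTensor_rect`,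
  plus: the zeroed slice is mapped into the deleted coordinate);
* `exists_isUnit_det_mulVec_eq_single_of_ne` — `x_j ≠ 0` ⇒ an invertible `P` with `P x = e_j`
  whose columns `≠ j` are those of `1` (`P = 1 + (e_j − x)(x_j⁻¹ e_j)ᵀ`);
* `fullRowComb_card_le` / `fullColComb_card_le` — for `x` with `x_j ≠ 0`, `j ≠ 0`, and `D` a set
  of products whose `X`-form is `(x ⊗ y_ρ)|_{b ≠ (0,0)}` (row combination `x`) resp.
  `(y_ρ ⊗ x)|` (column combination): `R(⟨2,3,3⟩ ∖ X₀₀) + 3 + |D| ≤ |σ| + ⌊|D|/3⌋`;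
* `fullRowComb_card_le_three` / `fullColComb_card_le_three` — with `14 ≤ R(⟨2,3,3⟩ ∖ X₀₀)` (over
  `𝔽₂`: orbit `[1]` of the tree's `⟨2,3,3⟩` sweep, through `ConstrainedMatMulCoordinateTensor.lean`)
  and `|σ| ≤ 19`: **`|D| ≤ 3`** for every full row/column combination of the `X`-slot.

## References

* J. E. Hopcroft, L. R. Kerr, *On minimizing the number of multiplications necessary for matrix
  multiplication*, SIAM J. Appl. Math. 20 (1971) 30–36 (= Cornell TR 69-44, 1969), Lemma 7 and the
  remark following it (p. 23 of the TR). [HopcroftKerr1971]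
* H. F. de Groote, *On varieties of optimal algorithms for the computation of bilinear mappings I*,
  Theoret. Comput. Sci. 7 (1978) 1–24, §3 (sandwich symmetries). [Degroote1978]
-/

namespace Literature.Computability.AlgebraicComplexity

open Module Matrix
open scoped Kronecker

namespace HopcroftKerrRow

variable {K : Type*} [Field K]

/-! ## §1 Extension by zero and transport inside the stabiliser of the deleted entry -/

/-- A decomposition of `⟨k+1,m+1,n⟩ ∖ X₀₀`, with its `X`-factors extended by `0` at the deleted
coordinate `(0,0)`, sums to `⟨k+1,m+1,n⟩` with the `X₀₀`-slice replaced by `0`. [folklore] -/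
private theorem delete00_sum_triad_extend {k m n : ℕ} {σ : Type*} [Fintype σ]
    {w : σ → Fin (k + 1) × Fin n → K} {u : σ → {b : Fin (k + 1) × Fin (m + 1) // b ≠ (0, 0)} → K}
    {v : σ → Fin (m + 1) × Fin n → K}
    (ht : (fun (a : Fin (k + 1) × Fin n) (b : {b : Fin (k + 1) × Fin (m + 1) // b ≠ (0, 0)})
      (c : Fin (m + 1) × Fin n) => matMulTensor K (k + 1) (m + 1) n a b.1 c) =
      ∑ ρ, triad (w ρ) (u ρ) (v ρ)) :
    (∑ ρ, triad (w ρ) (fun b : Fin (k + 1) × Fin (m + 1) =>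
        if h : b = (0, 0) then (0 : K) else u ρ ⟨b, h⟩) (v ρ)) =
      fun a b c => if b = (0, 0) then 0 else matMulTensor K (k + 1) (m + 1) n a b c := by
  funext a b c
  rw [Finset.sum_apply, Finset.sum_apply, Finset.sum_apply]
  by_cases hb : b = (0, 0)
  · simp [triad_apply, hb]
  · have e := congrFun (congrFun (congrFun ht a) ⟨b, hb⟩) c
    simp only [Finset.sum_apply, triad_apply] at e
    simp only [triad_apply, dif_neg hb, if_neg hb]
    exact e.symm

/-- The sandwich matrices fixing the deleted coordinate kill the `(0,0)` column on admissible rows: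
if `P_{i0} = 0` for `i ≠ 0` and `Q_{j0} = 0` for `j ≠ 0` then `(P ⊗ Q)_{b,(0,0)} = 0` for every
`b ≠ (0,0)`. [folklore] -/
private theorem kronecker_apply_zero_zero_eq_zero {k m : ℕ} (P : Matrix (Fin (k + 1)) (Fin (k + 1)) K)
    (Q : Matrix (Fin (m + 1)) (Fin (m + 1)) K) (hP0 : ∀ i, i ≠ 0 → P i 0 = 0)
    (hQ0 : ∀ j, j ≠ 0 → Q j 0 = 0) (b : Fin (k + 1) × Fin (m + 1)) (hb : b ≠ (0, 0)) :
    (P ⊗ₖ Q) b ((0 : Fin (k + 1)), (0 : Fin (m + 1))) = 0 := by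
  obtain ⟨i, j⟩ := b
  simp only [Matrix.kroneckerMap_apply]
  by_cases hi : i = 0
  · have hj : j ≠ 0 := fun hj => hb (by rw [hi, hj])
    rw [hQ0 j hj, mul_zero]
  · rw [hP0 i hi, zero_mul]

/-- **Transport inside the stabiliser of the deleted entry.**  Let `∑_ρ w_ρ ⊗ u_ρ ⊗ v_ρ` be a
decomposition of `⟨k+1,m+1,n⟩ ∖ X₀₀` and `P, Q, R` invertible with the columns `0` of `P` and `Q`
multiples of `e₀`.  Then the sandwiched factors — `(P⁻ᵀ ⊗ R⁻ᵀ) w_ρ`, the restriction to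
`b ≠ (0,0)` of `(P ⊗ Q) ū_ρ` (`ū_ρ` = `u_ρ` extended by `0`), `(Q⁻ᵀ ⊗ R) v_ρ` — decompose the same
tensor (de Groote's sandwich symmetry of `⟨k+1,m+1,n⟩` restricted to the subgroup mapping the
constraint `X₀₀ = 0` to itself; Hopcroft–Kerr's "by transformations").
[cite: Degroote1978, §3; HopcroftKerr1971, Lemma 7 (remark)] -/
theorem delete00_sum_triad_sandwich {k m n : ℕ} (P : Matrix (Fin (k + 1)) (Fin (k + 1)) K)
    (Q : Matrix (Fin (m + 1)) (Fin (m + 1)) K) (R : Matrix (Fin n) (Fin n) K) (hP : IsUnit P.det)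
    (hQ : IsUnit Q.det) (hR : IsUnit R.det) (hP0 : ∀ i, i ≠ 0 → P i 0 = 0)
    (hQ0 : ∀ j, j ≠ 0 → Q j 0 = 0) {σ : Type*} [Fintype σ]
    {w : σ → Fin (k + 1) × Fin n → K} {u : σ → {b : Fin (k + 1) × Fin (m + 1) // b ≠ (0, 0)} → K}
    {v : σ → Fin (m + 1) × Fin n → K}
    (ht : (fun (a : Fin (k + 1) × Fin n) (b : {b : Fin (k + 1) × Fin (m + 1) // b ≠ (0, 0)})
      (c : Fin (m + 1) × Fin n) => matMulTensor K (k + 1) (m + 1) n a b.1 c) =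
      ∑ ρ, triad (w ρ) (u ρ) (v ρ)) :
    (fun (a : Fin (k + 1) × Fin n) (b : {b : Fin (k + 1) × Fin (m + 1) // b ≠ (0, 0)})
      (c : Fin (m + 1) × Fin n) => matMulTensor K (k + 1) (m + 1) n a b.1 c) =
      ∑ ρ, triad ((P⁻¹ᵀ ⊗ₖ R⁻¹ᵀ) *ᵥ w ρ)
        (fun b : {b : Fin (k + 1) × Fin (m + 1) // b ≠ (0, 0)} =>
          ((P ⊗ₖ Q) *ᵥ fun b' : Fin (k + 1) × Fin (m + 1) =>
            if h : b' = (0, 0) then (0 : K) else u ρ ⟨b', h⟩) b.1)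
        ((Q⁻¹ᵀ ⊗ₖ R) *ᵥ v ρ) := by
  classical
  have hext := delete00_sum_triad_extend ht
  -- `⟨k+1,m+1,n⟩` = (slice-zeroed part) + (the `X₀₀`-slice)
  have hsplit : matMulTensor K (k + 1) (m + 1) n =
      (fun a b c => if b = (0, 0) then 0 else matMulTensor K (k + 1) (m + 1) n a b c) +
      (fun a b c => if b = (0, 0) then matMulTensor K (k + 1) (m + 1) n a b c else 0) := by
    funext a b c
    simp only [Pi.add_apply]
    split_ifs <;> simp
  -- the action of the stabiliser on the slice-zeroed part agrees with `⟨k+1,m+1,n⟩` off `(0,0)`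
  have hact : ∀ (a : Fin (k + 1) × Fin n) (b : {b : Fin (k + 1) × Fin (m + 1) // b ≠ (0, 0)})
      (c : Fin (m + 1) × Fin n),
      actTensor (P⁻¹ᵀ ⊗ₖ R⁻¹ᵀ) (P ⊗ₖ Q) (Q⁻¹ᵀ ⊗ₖ R)
        (fun a b c => if b = (0, 0) then 0 else matMulTensor K (k + 1) (m + 1) n a b c) a b.1 c =
      matMulTensor K (k + 1) (m + 1) n a b.1 c := by
    intro a b c
    have hfix := actTensor_sandwich_matMulTensor_rect P Q R hP hQ hR
    have hSl0 : actTensor (P⁻¹ᵀ ⊗ₖ R⁻¹ᵀ) (P ⊗ₖ Q) (Q⁻¹ᵀ ⊗ₖ R)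
        (fun a b c => if b = (0, 0) then matMulTensor K (k + 1) (m + 1) n a b c else 0) a b.1 c = 0 := by
      rw [actTensor_apply]
      refine Finset.sum_eq_zero fun a' _ => Finset.sum_eq_zero fun b' _ =>
        Finset.sum_eq_zero fun c' _ => ?_
      by_cases hb' : b' = (0, 0)
      · rw [hb', kronecker_apply_zero_zero_eq_zero P Q hP0 hQ0 b.1 b.2]
        simp
      · simp [hb']
    have e := congrFun (congrFun (congrFun hfix a) b.1) c
    conv_lhs at e => rw [hsplit, actTensor_add_tensor]
    rw [Pi.add_apply, Pi.add_apply, Pi.add_apply, hSl0, add_zero] at e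
    exact e
  funext a b c
  show matMulTensor K (k + 1) (m + 1) n a b.1 c = _
  rw [← hact a b c, ← hext, actTensor_finset_sum_tensor, Finset.sum_apply, Finset.sum_apply,
    Finset.sum_apply, Finset.sum_apply, Finset.sum_apply, Finset.sum_apply]
  refine Finset.sum_congr rfl fun ρ _ => ?_
  rw [actTensor_triad, triad_apply, triad_apply]

/-! ## §2 A vector with a nonzero coordinate is that coordinate vector up to the stabiliser -/

/-- If `x_j ≠ 0` then `P = 1 + (e_j − x)(x_j⁻¹ e_j)ᵀ` is invertible (`det P = x_j⁻¹`, matrix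
determinant lemma), `P x = e_j`, and the columns `≠ j` of `P` are those of `1` (so `P` fixes every
`e_i`, `i ≠ j`). [folklore] -/
private theorem exists_isUnit_det_mulVec_eq_single_of_ne {k : ℕ} {x : Fin k → K} (j : Fin k)
    (hj : x j ≠ 0) :
    ∃ P : Matrix (Fin k) (Fin k) K, IsUnit P.det ∧ P *ᵥ x = Pi.single j 1 ∧
      ∀ i i', i' ≠ j → P i i' = (1 : Matrix (Fin k) (Fin k) K) i i' := by
  refine ⟨1 + vecMulVec (Pi.single j 1 - x) ((x j)⁻¹ • Pi.single j 1), ?_, ?_, ?_⟩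
  · rw [vecMulVec_eq (Fin 1), det_one_add_replicateCol_mul_replicateRow, smul_dotProduct,
      dotProduct_sub, single_dotProduct, single_dotProduct, one_mul, one_mul, Pi.single_eq_same,
      smul_eq_mul]
    have h1 : (1 : K) + (x j)⁻¹ * (1 - x j) = (x j)⁻¹ := by
      field_simp
      ring
    rw [h1]
    exact isUnit_iff_ne_zero.2 (inv_ne_zero hj)
  · rw [add_mulVec, one_mulVec, vecMulVec_mulVec, smul_dotProduct, single_dotProduct, one_mul,
      smul_eq_mul, inv_mul_cancel₀ hj, MulOpposite.op_one, one_smul, add_sub_cancel]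
  · intro i i' hi'
    rw [Matrix.add_apply, vecMulVec_apply, Pi.smul_apply, Pi.single_eq_of_ne hi', smul_zero,
      mul_zero, add_zero]

/-- `((P ⊗ 1) f)(i, l) = ∑_{i'} P_{i i'} f(i', l)`. [folklore] -/
private theorem kronecker_one_mulVec_apply {k m : ℕ} (P : Matrix (Fin k) (Fin k) K) (f : Fin k × Fin m → K)
    (i : Fin k) (l : Fin m) :
    ((P ⊗ₖ (1 : Matrix (Fin m) (Fin m) K)) *ᵥ f) (i, l) = ∑ i', P i i' * f (i', l) := by
  rw [Matrix.mulVec, dotProduct, Fintype.sum_prod_type]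
  refine Finset.sum_congr rfl fun i' _ => ?_
  rw [Finset.sum_eq_single l (fun l' _ hl' => by simp [Ne.symm hl']) (by simp)]
  simp

/-! ## §3 Full row and column combinations of `⟨3,3,3⟩ ∖ X₀₀` -/

/-- **Full row COMBINATIONS of `⟨3,3,3⟩ minus a₀₀`.**  Let `x ∈ K³` with `x_j ≠ 0` for some
`j ≠ 0` (every row class except the deficient one `x ∝ e₀`), and `D` a set of products whose
`X`-form reads only the row combination `xᵀX`: `u_ρ(b) = x_{b₁} y_ρ(b₂)` on the admissible entries.
Then `R(⟨2,3,3⟩ ∖ X₀₀) + 3 + |D| ≤ |σ| + ⌊|D|/3⌋` — the transport of `fullRow_card_le` along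
`delete00_sum_triad_sandwich` with `P x = e_j`, `P e₀ = e₀`.
[cite: HopcroftKerr1971, Lemma 7 (Corollary and remark)] -/
theorem fullRowComb_card_le {σ : Type*} [Fintype σ] [DecidableEq σ]
    {w : σ → Fin 3 × Fin 3 → K} {u : σ → {b : Fin 3 × Fin 3 // b ≠ (0, 0)} → K}
    {v : σ → Fin 3 × Fin 3 → K} (ht : (fun (a : Fin 3 × Fin 3) (b : {b : Fin 3 × Fin 3 // b ≠ (0, 0)})
      (c : Fin 3 × Fin 3) => matMulTensor K 3 3 3 a b.1 c) = ∑ ρ, triad (w ρ) (u ρ) (v ρ))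
    {x : Fin 3 → K} (j : Fin 3) (hj : j ≠ 0) (hxj : x j ≠ 0) (D : Finset σ)
    (hD : ∀ ρ ∈ D, ∃ y : Fin 3 → K, ∀ b : {b : Fin 3 × Fin 3 // b ≠ (0, 0)}, u ρ b = x b.1.1 * y b.1.2) :
    tensorRank ((fun (a : Fin 2 × Fin 3) (b : {b : Fin 2 × Fin 3 // b ≠ (0, 0)}) (c : Fin 3 × Fin 3) =>
      matMulTensor K 2 3 3 a b.1 c)) + 3 + D.card ≤ Fintype.card σ + D.card / 3 := by
  classical
  obtain ⟨P, hP, hPx, hPcol⟩ := exists_isUnit_det_mulVec_eq_single_of_ne j hxj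
  have h1 : IsUnit (1 : Matrix (Fin 3) (Fin 3) K).det := by rw [det_one]; exact isUnit_one
  have hP0 : ∀ i : Fin 3, i ≠ 0 → P i 0 = 0 := fun i hi => by
    rw [hPcol i 0 hj.symm, Matrix.one_apply, if_neg hi]
  have hQ0 : ∀ i : Fin 3, i ≠ 0 → (1 : Matrix (Fin 3) (Fin 3) K) i 0 = 0 := fun i hi => by
    rw [Matrix.one_apply, if_neg hi]
  have ht' := delete00_sum_triad_sandwich P 1 1 hP h1 h1 hP0 hQ0 ht
  refine fullRow_card_le ht' j hj D fun ρ hρ b hb => ?_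
  obtain ⟨y, hy⟩ := hD ρ hρ
  obtain ⟨⟨i, l⟩, hil⟩ := b
  simp only at hb
  show ((P ⊗ₖ (1 : Matrix (Fin 3) (Fin 3) K)) *ᵥ fun b' : Fin 3 × Fin 3 =>
    if h : b' = (0, 0) then (0 : K) else u ρ ⟨b', h⟩) (i, l) = 0
  rw [kronecker_one_mulVec_apply]
  have hPxi : ∑ i', P i i' * x i' = 0 := by
    have e := congrFun hPx i
    rw [Matrix.mulVec, dotProduct] at e
    rw [e, Pi.single_eq_of_ne hb]
  by_cases hl : l = 0
  · subst hl
    have hi : i ≠ 0 := fun hi => hil (by rw [hi])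
    -- the term `i' = 0` is the deleted coordinate, the others read `x_{i'} y_0`
    have hterm : ∀ i', P i i' * (if h : ((i', (0 : Fin 3)) : Fin 3 × Fin 3) = (0, 0) then (0 : K)
        else u ρ ⟨(i', 0), h⟩) = P i i' * x i' * y 0 := by
      intro i'
      by_cases hi' : i' = 0
      · subst hi'
        rw [hP0 i hi, zero_mul, zero_mul, zero_mul]
      · have hne : ((i', (0 : Fin 3)) : Fin 3 × Fin 3) ≠ (0, 0) := fun h => hi' (Prod.ext_iff.1 h).1
        rw [dif_neg hne, hy ⟨(i', 0), hne⟩, mul_assoc]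
    simp_rw [hterm, ← Finset.sum_mul, hPxi, zero_mul]
  · have hterm : ∀ i', P i i' * (if h : ((i', l) : Fin 3 × Fin 3) = (0, 0) then (0 : K)
        else u ρ ⟨(i', l), h⟩) = P i i' * x i' * y l := by
      intro i'
      have hne : ((i', l) : Fin 3 × Fin 3) ≠ (0, 0) := fun h => hl (Prod.ext_iff.1 h).2
      rw [dif_neg hne, hy ⟨(i', l), hne⟩, mul_assoc]
    simp_rw [hterm, ← Finset.sum_mul, hPxi, zero_mul]

/-- **Full column COMBINATIONS of `⟨3,3,3⟩ minus a₀₀`** (`x_j ≠ 0`, `j ≠ 0`; forms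
`u_ρ(b) = y_ρ(b₁) x_{b₂}` reading only the column combination `Xx`): the same inequality, through
the symmetry `(A,B,C) ↦ (Aᵀ,Cᵀ,Bᵀ)` (`T333minus00_swap_transpose_eq_sum`).
[cite: HopcroftKerr1971, Lemma 7 (Corollary and remark)] -/
theorem fullColComb_card_le {σ : Type*} [Fintype σ] [DecidableEq σ]
    {w : σ → Fin 3 × Fin 3 → K} {u : σ → {b : Fin 3 × Fin 3 // b ≠ (0, 0)} → K}
    {v : σ → Fin 3 × Fin 3 → K} (ht : (fun (a : Fin 3 × Fin 3) (b : {b : Fin 3 × Fin 3 // b ≠ (0, 0)})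
      (c : Fin 3 × Fin 3) => matMulTensor K 3 3 3 a b.1 c) = ∑ ρ, triad (w ρ) (u ρ) (v ρ))
    {x : Fin 3 → K} (j : Fin 3) (hj : j ≠ 0) (hxj : x j ≠ 0) (D : Finset σ)
    (hD : ∀ ρ ∈ D, ∃ y : Fin 3 → K, ∀ b : {b : Fin 3 × Fin 3 // b ≠ (0, 0)}, u ρ b = y b.1.1 * x b.1.2) :
    tensorRank ((fun (a : Fin 2 × Fin 3) (b : {b : Fin 2 × Fin 3 // b ≠ (0, 0)}) (c : Fin 3 × Fin 3) =>
      matMulTensor K 2 3 3 a b.1 c)) + 3 + D.card ≤ Fintype.card σ + D.card / 3 :=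
  fullRowComb_card_le (T333minus00_swap_transpose_eq_sum ht) j hj hxj D fun ρ hρ => by
    obtain ⟨y, hy⟩ := hD ρ hρ
    exact ⟨y, fun b => by rw [hy]; simp [mul_comm]⟩

/-- **Cap 3 on every full row combination of `⟨3,3,3⟩ ∖ X₀₀` at length `≤ 19`**, given
`14 ≤ R(⟨2,3,3⟩ ∖ X₀₀)` (over `𝔽₂`: the orbit `[1]` of the tree's `⟨2,3,3⟩` sweep, read through
`le_tensorRank_matMulTensor233_delete00_of_forall_constrained`): `14 + 3 + k ≤ 19 + ⌊k/3⌋` forces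
`k ≤ 3`. [cite: HopcroftKerr1971, Lemma 7 (Corollary and remark)] -/
theorem fullRowComb_card_le_three {σ : Type*} [Fintype σ] [DecidableEq σ]
    (h14 : 14 ≤ tensorRank ((fun (a : Fin 2 × Fin 3) (b : {b : Fin 2 × Fin 3 // b ≠ (0, 0)})
      (c : Fin 3 × Fin 3) => matMulTensor K 2 3 3 a b.1 c)))
    {w : σ → Fin 3 × Fin 3 → K} {u : σ → {b : Fin 3 × Fin 3 // b ≠ (0, 0)} → K}
    {v : σ → Fin 3 × Fin 3 → K} (ht : (fun (a : Fin 3 × Fin 3) (b : {b : Fin 3 × Fin 3 // b ≠ (0, 0)})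
      (c : Fin 3 × Fin 3) => matMulTensor K 3 3 3 a b.1 c) = ∑ ρ, triad (w ρ) (u ρ) (v ρ))
    (hσ : Fintype.card σ ≤ 19)
    {x : Fin 3 → K} (j : Fin 3) (hj : j ≠ 0) (hxj : x j ≠ 0) (D : Finset σ)
    (hD : ∀ ρ ∈ D, ∃ y : Fin 3 → K, ∀ b : {b : Fin 3 × Fin 3 // b ≠ (0, 0)}, u ρ b = x b.1.1 * y b.1.2) :
    D.card ≤ 3 := by
  have h := fullRowComb_card_le ht j hj hxj D hD
  omega

/-- **Cap 3 on every full column combination of `⟨3,3,3⟩ ∖ X₀₀` at length `≤ 19`**, given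
`14 ≤ R(⟨2,3,3⟩ ∖ X₀₀)`. [cite: HopcroftKerr1971, Lemma 7 (Corollary and remark)] -/
theorem fullColComb_card_le_three {σ : Type*} [Fintype σ] [DecidableEq σ]
    (h14 : 14 ≤ tensorRank ((fun (a : Fin 2 × Fin 3) (b : {b : Fin 2 × Fin 3 // b ≠ (0, 0)})
      (c : Fin 3 × Fin 3) => matMulTensor K 2 3 3 a b.1 c)))
    {w : σ → Fin 3 × Fin 3 → K} {u : σ → {b : Fin 3 × Fin 3 // b ≠ (0, 0)} → K}
    {v : σ → Fin 3 × Fin 3 → K} (ht : (fun (a : Fin 3 × Fin 3) (b : {b : Fin 3 × Fin 3 // b ≠ (0, 0)})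
      (c : Fin 3 × Fin 3) => matMulTensor K 3 3 3 a b.1 c) = ∑ ρ, triad (w ρ) (u ρ) (v ρ))
    (hσ : Fintype.card σ ≤ 19)
    {x : Fin 3 → K} (j : Fin 3) (hj : j ≠ 0) (hxj : x j ≠ 0) (D : Finset σ)
    (hD : ∀ ρ ∈ D, ∃ y : Fin 3 → K, ∀ b : {b : Fin 3 × Fin 3 // b ≠ (0, 0)}, u ρ b = y b.1.1 * x b.1.2) :
    D.card ≤ 3 := by
  have h := fullColComb_card_le ht j hj hxj D hD
  omega

end HopcroftKerrRow

end Literature.Computability.AlgebraicComplexity
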